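import Literature.Analysis.FluidPDE.Tao2016AveragedNS.DelayCircuit
import Literature.Analysis.ODE.AprioriTwoSided
import Literature.Analysis.ODE.ConfinedAutonomous
import HarnessLib

/-!
# Tao 2016, §5: quadratic circuits are globally well posed (existence and uniqueness of trajectories)

T. Tao, *Finite time blowup for an averaged three-dimensional Navier–Stokes equation*, J. Amer.
Math. Soc. **29** (2016) 601–674 = arXiv:1402.0290, §5 "Quadratic circuits", p. 25:

> "… `G : ℝ^m × ℝ^m → ℝ^m` is a bilinear operator obeying the cancellation condition `G(X,X)·X = 0`
> for all `X ∈ ℝ^m` (so in particular, the flow (ode) preserves the norm of `X`, **and so the ODE is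
> globally well posed**)."

The sibling files `QuadraticCircuits.lean` / `DelayCircuit.lean` prove the first half of the
parenthesis (energy conservation, `energy_eq_of_isCancelling`) and record Theorem 5.3 as the named
fact `DelayedAbruptTransition`, which quantifies over "every global trajectory `X : ℝ → ℝ⁵` of the
delay circuit (5.5) with `X 0 = (1,0,0,0,0)`" without asserting that such a trajectory exists
(cell pub-fluidc, DIVERGENCE.md D7(b)). This file PROVES the second half of the parenthesis and
thereby removes that caveat:

* `energy_eq_of_isCancelling_Icc` — energy conservation for solutions of `∂ₜX = c • F(X)` on an
  interval `[0, s]` (both signs of time), in the derivative-within convention of the tree's ODE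
  toolkit; `norm_le_sqrt_energy` — the a priori sup-norm bound `‖X‖ ≤ √(energy X)`;
* `IsCancelling.exists_solution` — **existence**: every cancelling `C¹` vector field `F` on `ℝ^m`
  has, through every initial state, a trajectory defined for ALL `t ∈ ℝ` (the tree's continuation
  principle `Literature.Analysis.ODE.exists_solution_real_of_apriori_bound`, Teschl 2012 Cor. 2.16,
  fed with the energy bound);
* `IsCancelling.solution_unique` — **uniqueness** among global trajectories (Mathlib's
  `ODE_solution_unique_univ` on the ball `‖X‖ ≤ √energy`, where both trajectories live);
* smoothness of the wired gates `pumpOn`, `amplifierOn`, `rotorOn`, of every `QuadraticCircuit`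
  field and of `delayCircuit K ε`; hence `QuadraticCircuit.exists_isSolution` /
  `QuadraticCircuit.isSolution_unique` and `delayCircuit_exists_solution` /
  `delayCircuit_solution_unique`;
* `delaySolution K ε` — THE trajectory of (5.5) issued from (5.6) (definition by choice,
  characterised by `delaySolution_zero`, `hasDerivAt_delaySolution`, `eq_delaySolution`), with
  `energy_delaySolution` (= (energy-con)) and `delaySolution_output_monotone`;
* Theorem 5.3 revisited: `HasAbruptTransition C K X` names the printed conclusion for one trajectory;
  `delayedAbruptTransition_iff_forall` (`Iff.rfl`: the named fact verbatim),
  `delayedAbruptTransition_iff_delaySolution` (the fact is a statement about the one trajectory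
  `delaySolution K ε`) and `delayedAbruptTransition_iff_exists` (witness form: "there is a trajectory
  from (5.6) exhibiting the delayed abrupt transition"). So the universal quantifier of the named
  fact ranges over exactly one, existing, object — the fact is not vacuous, and it is still NOT
  proved here (its content is the bootstrap of pp. 28–30);
* the unbounded second window is automatic: `HasAbruptTransitionAt C K X` collapses the window
  `t ≥ t_c + K^{-1/2}` to its first instant, `hasAbruptTransition_of_at` restores it for THE
  trajectory (monotone output + energy conservation; constant `C ↦ 2C + 4C²`), and
  `delayedAbruptTransition_iff_at` shows the named fact equivalent to this bounded reading — a proof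
  of Theorem 5.3 has to control `delaySolution K ε` on `[0, t_c + K^{-1/2}]` only (DIVERGENCE.md
  D7(c) made checkable).

HONEST FRAMING (cell pub-fluidc): part of a low prior, high value-of-information experiment on
Tao's machine paradigm; NOT a claim that NS blows up. Everything in this file is finite-dimensional
ODE theory; nothing is about the Navier–Stokes equations.

## Design choices
* States are `Fin m → ℝ` with the sup norm (as in the sibling files); the a priori bound is stated
  in that norm via `|Xᵢ| ≤ √(∑ Xⱼ²)`. Regularity hypothesis: `ContDiff ℝ 1 F` (every quadratic
  circuit is polynomial, hence smooth: `QuadraticCircuit.contDiff_field`), turned into Lipschitz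
  bounds on balls by the tree's `Literature.Analysis.ODE.exists_lipschitzOnWith_of_isCompact`.
* No new named facts. Three definitions: `delaySolution` (by `Classical.choose`, in the style of the
  tree's `Literature.Analysis.ODE.lipschitzFlow`) and the bookkeeping predicates
  `HasAbruptTransition` (the body of `DelayedAbruptTransition`, so that the equivalent forms of
  Theorem 5.3 can be stated without repeating it) and `HasAbruptTransitionAt` (its bounded reading).

## References
* T. Tao, JAMS 29 (2016) 601–674, arXiv:1402.0290: §5 (ode), (g-cancel) p. 25; §5.5 (5.5)/(5.6),
  Theorem 5.3, (energy-con) pp. 28–30. [`Tao2016AveragedNS`]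
* G. Teschl, *Ordinary Differential Equations and Dynamical Systems*, GSM 140 (AMS 2012), Cor. 2.16
  (global existence from a priori bounds), as formalised in `Literature/Analysis/ODE/`. [`Teschl2012`]
-/

noncomputable section

open Set Metric Filter
open scoped NNReal Topology

namespace Literature.Analysis.FluidPDE.Tao2016AveragedNS

variable {m : ℕ}

/-! ## Energy conservation on an interval and the a priori bound -/

/-- Chain rule for the energy along a trajectory, derivative-within form: `∂ₜ|X|² = 2 V·X`.
[folklore] -/
theorem hasDerivWithinAt_energy {X : ℝ → Fin m → ℝ} {V : Fin m → ℝ} {s : Set ℝ} {t : ℝ}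
    (hX : HasDerivWithinAt X V s t) :
    HasDerivWithinAt (fun r => energy (X r)) (2 * ∑ i, V i * X t i) s t := by
  have h : ∀ i ∈ (Finset.univ : Finset (Fin m)),
      HasDerivWithinAt (fun r => X r i ^ 2) (((2 : ℕ) : ℝ) * X t i ^ (2 - 1) * V i) s t :=
    fun i _ => (hasDerivWithinAt_pi.1 hX i).fun_pow 2
  refine (HasDerivWithinAt.fun_sum h).congr_deriv ?_
  rw [Finset.mul_sum]
  refine Finset.sum_congr rfl fun i _ => ?_
  simp only [show (2 : ℕ) - 1 = 1 from rfl, pow_one, Nat.cast_ofNat]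
  ring

/-- **The flow preserves the norm, on an interval and for both signs of time**: a solution of
`∂ₜX = c • F(X)` on `[0, s]` (`F` cancelling, `c` any real — `c = ±1` are the forward and the
time-reversed equations) has constant energy. [cite: Tao2016AveragedNS, §5 (ode)–(g-cancel)] -/
theorem energy_eq_of_isCancelling_Icc {F : (Fin m → ℝ) → (Fin m → ℝ)} (hF : IsCancelling F) (c : ℝ)
    {X : ℝ → Fin m → ℝ} {s : ℝ}
    (hX : ∀ t ∈ Icc 0 s, HasDerivWithinAt X (c • F (X t)) (Icc 0 s) t) {t : ℝ} (ht : t ∈ Icc 0 s) :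
    energy (X t) = energy (X 0) := by
  have hd : ∀ r ∈ Icc 0 s, HasDerivWithinAt (fun r => energy (X r)) 0 (Icc 0 s) r := by
    intro r hr
    have h := hasDerivWithinAt_energy (hX r hr)
    have hz : 2 * ∑ i, (c • F (X r)) i * X r i = 0 := by
      simp only [Pi.smul_apply, smul_eq_mul, mul_assoc, ← Finset.mul_sum, hF (X r), mul_zero]
    rwa [hz] at h
  have hcont : ContinuousOn (fun r => energy (X r)) (Icc 0 s) := fun r hr =>
    (hd r hr).continuousWithinAt
  have hder : ∀ r ∈ Ico 0 s, HasDerivWithinAt (fun r => energy (X r)) 0 (Ici r) r := fun r hr =>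
    (hd r (Ico_subset_Icc_self hr)).mono_of_mem_nhdsWithin
      (mem_of_superset (Icc_mem_nhdsGE hr.2) (Icc_subset_Icc hr.1 le_rfl))
  exact constant_of_has_deriv_right_zero hcont hder t ht

/-- Each mode is bounded by the square root of the energy: `|Xᵢ| ≤ √(∑ⱼ Xⱼ²)`. [folklore] -/
theorem abs_apply_le_sqrt_energy (X : Fin m → ℝ) (i : Fin m) : |X i| ≤ Real.sqrt (energy X) := by
  refine Real.abs_le_sqrt ?_
  show X i ^ 2 ≤ ∑ j, X j ^ 2
  exact Finset.single_le_sum (f := fun j => X j ^ 2) (fun j _ => sq_nonneg (X j)) (Finset.mem_univ i)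

/-- The a priori bound in the sup norm of `ℝ^m`: `‖X‖ ≤ √(energy X)`. [folklore] -/
theorem norm_le_sqrt_energy (X : Fin m → ℝ) : ‖X‖ ≤ Real.sqrt (energy X) :=
  (pi_norm_le_iff_of_nonneg (Real.sqrt_nonneg _)).2 fun i => by
    rw [Real.norm_eq_abs]
    exact abs_apply_le_sqrt_energy X i

/-! ## Global well-posedness of cancelling `C¹` circuits -/

/-- A `C¹` vector field on `ℝ^m` is Lipschitz on every closed ball (mean value inequality on a
compact convex set; the tree's `Literature.Analysis.ODE.exists_lipschitzOnWith_of_isCompact`).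
[folklore] -/
theorem exists_lipschitzOnWith_closedBall {F : (Fin m → ℝ) → (Fin m → ℝ)} (hF : ContDiff ℝ 1 F)
    (x : Fin m → ℝ) (ρ : ℝ) : ∃ C : ℝ≥0, LipschitzOnWith C F (closedBall x ρ) :=
  Literature.Analysis.ODE.exists_lipschitzOnWith_of_isCompact isOpen_univ hF.contDiffOn
    (isCompact_closedBall x ρ) (subset_univ _)

/-- **Global well-posedness of quadratic circuits — existence** (§5 p. 25: "the flow (ode)
preserves the norm of `X`, and so the ODE is globally well posed"). A cancelling `C¹` vector field
`F` on `ℝ^m` has, through every initial state `x₀`, a trajectory `X : ℝ → ℝ^m`, `X 0 = x₀`,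
`∂ₜX = F(X)` at EVERY real time: the energy bound `‖X(t)‖ ≤ √(energy x₀)` holds for the forward and
the time-reversed equation on every interval (`energy_eq_of_isCancelling_Icc`), so the continuation
principle (Teschl 2012, Cor. 2.16; tree: `exists_solution_real_of_apriori_bound`) applies.
[cite: Tao2016AveragedNS, §5 (ode)–(g-cancel)] -/
theorem IsCancelling.exists_solution {F : (Fin m → ℝ) → (Fin m → ℝ)} (hF : IsCancelling F)
    (hF' : ContDiff ℝ 1 F) (x₀ : Fin m → ℝ) :
    ∃ X : ℝ → Fin m → ℝ, X 0 = x₀ ∧ ∀ t, HasDerivAt X (F (X t)) t := by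
  refine Literature.Analysis.ODE.exists_solution_real_of_apriori_bound
    (fun ρ => exists_lipschitzOnWith_closedBall hF' 0 ρ) fun c _ T _ => ?_
  refine ⟨Real.sqrt (energy x₀), norm_le_sqrt_energy x₀, fun s _ α hα0 hα t ht => ?_⟩
  rw [← hα0, ← energy_eq_of_isCancelling_Icc hF c hα ht]
  exact norm_le_sqrt_energy (α t)

/-- **Global well-posedness of quadratic circuits — uniqueness**: two global trajectories of a
cancelling `C¹` field that agree at one time agree at all times (both stay in the ball
`‖X‖ ≤ √(energy (X t₀))` by energy conservation, on which `F` is Lipschitz; Picard–Lindelöf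
uniqueness, Mathlib `ODE_solution_unique_univ`). [cite: Tao2016AveragedNS, §5 (ode)–(g-cancel)] -/
theorem IsCancelling.solution_unique {F : (Fin m → ℝ) → (Fin m → ℝ)} (hF : IsCancelling F)
    (hF' : ContDiff ℝ 1 F) {X Y : ℝ → Fin m → ℝ} (hX : ∀ t, HasDerivAt X (F (X t)) t)
    (hY : ∀ t, HasDerivAt Y (F (Y t)) t) {t₀ : ℝ} (h : X t₀ = Y t₀) : X = Y := by
  obtain ⟨C, hC⟩ := exists_lipschitzOnWith_closedBall hF' 0 (Real.sqrt (energy (X t₀)))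
  refine ODE_solution_unique_univ (v := fun _ => F) (s := fun _ => closedBall 0 _)
    (fun _ => hC) (fun t => ⟨hX t, ?_⟩) (fun t => ⟨hY t, ?_⟩) h
  · rw [mem_closedBall_zero_iff, energy_eq_of_isCancelling hF hX t₀ t]
    exact norm_le_sqrt_energy _
  · rw [mem_closedBall_zero_iff, h, energy_eq_of_isCancelling hF hY t₀ t]
    exact norm_le_sqrt_energy _

/-! ## The gates and circuits of §5 are smooth -/

/-- A wired pump is a polynomial, hence smooth, vector field. [folklore] -/
theorem contDiff_pumpOn (κ : ℝ) (i j : Fin m) {n : WithTop ℕ∞} : ContDiff ℝ n (pumpOn κ i j) := by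
  have h1 : ContDiff ℝ n fun X : Fin m → ℝ => -(κ * X i * X j) := by fun_prop
  have h2 : ContDiff ℝ n fun X : Fin m → ℝ => κ * X i ^ 2 := by fun_prop
  exact ((contDiff_single (𝕜 := ℝ) (F' := fun _ : Fin m => ℝ) n i).comp h1).add
    ((contDiff_single (𝕜 := ℝ) (F' := fun _ : Fin m => ℝ) n j).comp h2)

/-- A wired amplifier is smooth. [folklore] -/
theorem contDiff_amplifierOn (κ : ℝ) (i j : Fin m) {n : WithTop ℕ∞} :
    ContDiff ℝ n (amplifierOn κ i j) := by
  have h1 : ContDiff ℝ n fun X : Fin m → ℝ => -(κ * X j ^ 2) := by fun_prop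
  have h2 : ContDiff ℝ n fun X : Fin m → ℝ => κ * X i * X j := by fun_prop
  exact ((contDiff_single (𝕜 := ℝ) (F' := fun _ : Fin m => ℝ) n i).comp h1).add
    ((contDiff_single (𝕜 := ℝ) (F' := fun _ : Fin m => ℝ) n j).comp h2)

/-- A wired rotor is smooth. [folklore] -/
theorem contDiff_rotorOn (κ : ℝ) (i j k : Fin m) {n : WithTop ℕ∞} :
    ContDiff ℝ n (rotorOn κ i j k) := by
  have h1 : ContDiff ℝ n fun X : Fin m → ℝ => -(κ * X j * X k) := by fun_prop
  have h2 : ContDiff ℝ n fun X : Fin m → ℝ => κ * X i * X k := by fun_prop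
  exact ((contDiff_single (𝕜 := ℝ) (F' := fun _ : Fin m => ℝ) n i).comp h1).add
    ((contDiff_single (𝕜 := ℝ) (F' := fun _ : Fin m => ℝ) n j).comp h2)

/-- The vector field `X ↦ G(X,X)` of a quadratic circuit is smooth (a polynomial map). [folklore] -/
theorem QuadraticCircuit.contDiff_field (c : QuadraticCircuit m) {n : WithTop ℕ∞} :
    ContDiff ℝ n c.field := by
  refine contDiff_pi.2 fun i => ?_
  simp only [QuadraticCircuit.field, QuadraticCircuit.G]
  fun_prop

/-- The delay circuit (5.5) is a smooth vector field (superposition of five smooth gates,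
`delayCircuit_eq_gates`). [cite: Tao2016AveragedNS, §5.5 (5.5)] -/
theorem contDiff_delayCircuit (K ε : ℝ) {n : WithTop ℕ∞} : ContDiff ℝ n (delayCircuit K ε) := by
  rw [delayCircuit_eq_gates]
  exact ((((contDiff_pumpOn _ _ _).add (contDiff_pumpOn _ _ _)).add
    (contDiff_amplifierOn _ _ _)).add (contDiff_rotorOn _ _ _ _)).add (contDiff_pumpOn _ _ _)

/-- **Every quadratic circuit is globally well posed** (existence): through every state passes a
global trajectory of `∂ₜX = G(X,X)`. [cite: Tao2016AveragedNS, §5 (ode)–(g-cancel)] -/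
theorem QuadraticCircuit.exists_isSolution (c : QuadraticCircuit m) (x₀ : Fin m → ℝ) :
    ∃ X : ℝ → Fin m → ℝ, X 0 = x₀ ∧ c.IsSolution X :=
  c.isCancelling_field.exists_solution c.contDiff_field x₀

/-- **Every quadratic circuit is globally well posed** (uniqueness). [cite: Tao2016AveragedNS, §5 (ode)–(g-cancel)] -/
theorem QuadraticCircuit.isSolution_unique (c : QuadraticCircuit m) {X Y : ℝ → Fin m → ℝ}
    (hX : c.IsSolution X) (hY : c.IsSolution Y) {t₀ : ℝ} (h : X t₀ = Y t₀) : X = Y :=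
  c.isCancelling_field.solution_unique c.contDiff_field hX hY h

/-! ## The trajectory of the delay circuit (5.5) from (5.6) -/

/-- The delay circuit (5.5) has a global trajectory from the initial datum (5.6) ("the solution to
the above system", Theorem 5.3). [cite: Tao2016AveragedNS, §5.5 (5.5)–(5.6)] -/
theorem delayCircuit_exists_solution (K ε : ℝ) :
    ∃ X : ℝ → Fin 5 → ℝ, X 0 = delayInit ∧ ∀ t, HasDerivAt X (delayCircuit K ε (X t)) t :=
  (isCancelling_delayCircuit K ε).exists_solution (contDiff_delayCircuit K ε) delayInit

/-- Global trajectories of (5.5) are determined by their state at time `0`.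
[cite: Tao2016AveragedNS, §5.5 (5.5)–(5.6)] -/
theorem delayCircuit_solution_unique (K ε : ℝ) {X Y : ℝ → Fin 5 → ℝ}
    (hX : ∀ t, HasDerivAt X (delayCircuit K ε (X t)) t)
    (hY : ∀ t, HasDerivAt Y (delayCircuit K ε (Y t)) t) (h : X 0 = Y 0) : X = Y :=
  (isCancelling_delayCircuit K ε).solution_unique (contDiff_delayCircuit K ε) hX hY h

/-- **The** trajectory `t ↦ (a,b,c,d,ã)(t)` of the delay circuit (5.5) with the initial datum (5.6)
— "the solution to the above system" of Theorem 5.3 — as a definition by choice from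
`delayCircuit_exists_solution`; characterised by `delaySolution_zero`, `hasDerivAt_delaySolution`
and uniqueness `eq_delaySolution`. [cite: Tao2016AveragedNS, §5.5 (5.5)–(5.6)] -/
def delaySolution (K ε : ℝ) : ℝ → Fin 5 → ℝ := (delayCircuit_exists_solution K ε).choose

/-- `delaySolution K ε` starts at (5.6). [cite: Tao2016AveragedNS, §5.5 (5.6)] -/
theorem delaySolution_zero (K ε : ℝ) : delaySolution K ε 0 = delayInit :=
  (delayCircuit_exists_solution K ε).choose_spec.1

/-- `delaySolution K ε` solves (5.5) at every real time. [cite: Tao2016AveragedNS, §5.5 (5.5)] -/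
theorem hasDerivAt_delaySolution (K ε t : ℝ) :
    HasDerivAt (delaySolution K ε) (delayCircuit K ε (delaySolution K ε t)) t :=
  (delayCircuit_exists_solution K ε).choose_spec.2 t

/-- Uniqueness: any global trajectory of (5.5) from (5.6) IS `delaySolution K ε`.
[cite: Tao2016AveragedNS, §5.5 (5.5)–(5.6)] -/
theorem eq_delaySolution {K ε : ℝ} {X : ℝ → Fin 5 → ℝ} (h0 : X 0 = delayInit)
    (hX : ∀ t, HasDerivAt X (delayCircuit K ε (X t)) t) : X = delaySolution K ε :=
  delayCircuit_solution_unique K ε hX (hasDerivAt_delaySolution K ε)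
    (h0.trans (delaySolution_zero K ε).symm)

/-- (energy-con) for the trajectory: `a² + b² + c² + d² + ã² = 1` at all times.
[cite: Tao2016AveragedNS, §5.5 (energy-con)] -/
theorem energy_delaySolution (K ε t : ℝ) : energy (delaySolution K ε t) = 1 :=
  delayCircuit_energy (hasDerivAt_delaySolution K ε) (delaySolution_zero K ε) t

/-- The output mode `ã` of the trajectory is non-decreasing (`K ≥ 0`). [cite: Tao2016AveragedNS, §5.5 proof] -/
theorem delaySolution_output_monotone {K : ℝ} (hK : 0 ≤ K) (ε : ℝ) :
    Monotone fun t => delaySolution K ε t 4 :=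
  delayCircuit_output_monotone hK (hasDerivAt_delaySolution K ε)

/-! ## Theorem 5.3, three equivalent readings -/

/-- The CONCLUSION of Theorem 5.3 for one trajectory `X = (a,b,c,d,ã)` with constants `C`, `K`:
there is `t_c` with `|t_c - √2| ≤ C/√K` such that `|a-1|, |b|, |c|, |d|, |ã| ≤ C K⁻¹⁰` on
`[0, t_c - 1/√K]` and `|ã-1|, |a|, |b|, |c|, |d| ≤ C K⁻¹⁰` for `t ≥ t_c + 1/√K` — the body of the
named fact `DelayedAbruptTransition`, isolated. [cite: Tao2016AveragedNS, Theorem 5.3] -/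
def HasAbruptTransition (C K : ℝ) (X : ℝ → Fin 5 → ℝ) : Prop :=
  ∃ tc : ℝ, |tc - Real.sqrt 2| ≤ C / Real.sqrt K ∧
    (∀ t ∈ Set.Icc 0 (tc - 1 / Real.sqrt K),
      |X t 0 - 1| ≤ C / K ^ 10 ∧ ∀ i : Fin 5, i ≠ 0 → |X t i| ≤ C / K ^ 10) ∧
    (∀ t, tc + 1 / Real.sqrt K ≤ t →
      |X t 4 - 1| ≤ C / K ^ 10 ∧ ∀ i : Fin 5, i ≠ 4 → |X t i| ≤ C / K ^ 10)

/-- The named fact `DelayedAbruptTransition`, verbatim, in terms of `HasAbruptTransition` (by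
`Iff.rfl`): "for every global trajectory from (5.6) …". [cite: Tao2016AveragedNS, Theorem 5.3] -/
theorem delayedAbruptTransition_iff_forall :
    DelayedAbruptTransition ↔
      ∃ C : ℝ, 0 < C ∧ ∃ K₀ : ℝ, 0 < K₀ ∧ ∀ K : ℝ, K₀ ≤ K → ∃ ε₁ : ℝ, 0 < ε₁ ∧
        ∀ ε : ℝ, 0 < ε → ε ≤ ε₁ → ∀ X : ℝ → Fin 5 → ℝ, X 0 = delayInit →
          (∀ t, HasDerivAt X (delayCircuit K ε (X t)) t) → HasAbruptTransition C K X :=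
  Iff.rfl

/-- **Theorem 5.3 is a statement about one object.** The named fact `DelayedAbruptTransition` is
equivalent to the same assertion about THE trajectory `delaySolution K ε` (existence
`delayCircuit_exists_solution` + uniqueness `eq_delaySolution`): its universal quantifier over
trajectories ranges over exactly one, existing, function — the fact is not vacuous.
[cite: Tao2016AveragedNS, Theorem 5.3] -/
theorem delayedAbruptTransition_iff_delaySolution :
    DelayedAbruptTransition ↔
      ∃ C : ℝ, 0 < C ∧ ∃ K₀ : ℝ, 0 < K₀ ∧ ∀ K : ℝ, K₀ ≤ K → ∃ ε₁ : ℝ, 0 < ε₁ ∧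
        ∀ ε : ℝ, 0 < ε → ε ≤ ε₁ → HasAbruptTransition C K (delaySolution K ε) := by
  refine exists_congr fun C => and_congr_right fun _ => exists_congr fun K₀ =>
    and_congr_right fun _ => forall₂_congr fun K _ => exists_congr fun ε₁ =>
    and_congr_right fun _ => forall₃_congr fun ε _ _ => ⟨fun h => ?_, fun h X h0 hX => ?_⟩
  · exact h _ (delaySolution_zero K ε) (hasDerivAt_delaySolution K ε)
  · rwa [eq_delaySolution h0 hX]

/-- **Theorem 5.3, witness form**: the named fact is equivalent to "for `K` large and `ε` small
THERE IS a trajectory of (5.5) from (5.6) exhibiting the delayed abrupt energy transition".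
[cite: Tao2016AveragedNS, Theorem 5.3] -/
theorem delayedAbruptTransition_iff_exists :
    DelayedAbruptTransition ↔
      ∃ C : ℝ, 0 < C ∧ ∃ K₀ : ℝ, 0 < K₀ ∧ ∀ K : ℝ, K₀ ≤ K → ∃ ε₁ : ℝ, 0 < ε₁ ∧
        ∀ ε : ℝ, 0 < ε → ε ≤ ε₁ → ∃ X : ℝ → Fin 5 → ℝ, X 0 = delayInit ∧
          (∀ t, HasDerivAt X (delayCircuit K ε (X t)) t) ∧ HasAbruptTransition C K X := by
  rw [delayedAbruptTransition_iff_delaySolution]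
  refine exists_congr fun C => and_congr_right fun _ => exists_congr fun K₀ =>
    and_congr_right fun _ => forall₂_congr fun K _ => exists_congr fun ε₁ =>
    and_congr_right fun _ => forall₃_congr fun ε _ _ => ⟨fun h => ?_, fun h => ?_⟩
  · exact ⟨delaySolution K ε, delaySolution_zero K ε, hasDerivAt_delaySolution K ε, h⟩
  · obtain ⟨X, h0, hX, hT⟩ := h
    rwa [← eq_delaySolution h0 hX]

/-! ## The unbounded second window of Theorem 5.3 is automatic

Tao's proof of Theorem 5.3 (pp. 28–31) is a bootstrap on a bounded time interval; the printed
conclusion for ALL `t ≥ t_c + K^{-1/2}` then follows from two structural facts already in the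
tree — the output mode `ã` is non-decreasing (`delaySolution_output_monotone`) and the energy is
conserved (`energy_delaySolution`): once `a, b, c, d = O(K⁻¹⁰)` at the single instant
`t₁ = t_c + K^{-1/2}`, the residual energy `a² + b² + c² + d² = 1 - ã²` can only decrease. The
theorems below make this reduction checkable: the named fact `DelayedAbruptTransition` is
equivalent to its reading with the second window collapsed to its first instant (implied constant
`C ↦ 2C + 4C²`, threshold `K₀ ↦ max K₀ (C + 1)`), so a proof of Theorem 5.3 only has to control
THE trajectory `delaySolution K ε` on `[0, t_c + K^{-1/2}]`. -/

/-- Bookkeeping predicate: the conclusion of Theorem 5.3 for one trajectory `X = (a,b,c,d,ã)` with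
the second window `t ≥ t_c + 1/√K` collapsed to its first instant `t₁ = t_c + 1/√K`.
[cite: Tao2016AveragedNS, Theorem 5.3] -/
def HasAbruptTransitionAt (C K : ℝ) (X : ℝ → Fin 5 → ℝ) : Prop :=
  ∃ tc : ℝ, |tc - Real.sqrt 2| ≤ C / Real.sqrt K ∧
    (∀ t ∈ Set.Icc 0 (tc - 1 / Real.sqrt K),
      |X t 0 - 1| ≤ C / K ^ 10 ∧ ∀ i : Fin 5, i ≠ 0 → |X t i| ≤ C / K ^ 10) ∧
    (|X (tc + 1 / Real.sqrt K) 4 - 1| ≤ C / K ^ 10 ∧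
      ∀ i : Fin 5, i ≠ 4 → |X (tc + 1 / Real.sqrt K) i| ≤ C / K ^ 10)

/-- The printed conclusion implies the collapsed one (take `t = t₁`). [cite: Tao2016AveragedNS, Theorem 5.3] -/
theorem HasAbruptTransition.hasAbruptTransitionAt {C K : ℝ} {X : ℝ → Fin 5 → ℝ}
    (h : HasAbruptTransition C K X) : HasAbruptTransitionAt C K X := by
  obtain ⟨tc, htc, hbefore, hafter⟩ := h
  exact ⟨tc, htc, hbefore, hafter _ le_rfl⟩

/-- Monotonicity of the conclusion of Theorem 5.3 in the implied constant (`K ≥ 0`).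
[cite: Tao2016AveragedNS, Theorem 5.3] -/
theorem HasAbruptTransition.mono {C C' K : ℝ} {X : ℝ → Fin 5 → ℝ}
    (h : HasAbruptTransition C K X) (hK : 0 ≤ K) (hCC' : C ≤ C') :
    HasAbruptTransition C' K X := by
  have h1 : C / Real.sqrt K ≤ C' / Real.sqrt K :=
    div_le_div_of_nonneg_right hCC' (Real.sqrt_nonneg K)
  have h2 : C / K ^ 10 ≤ C' / K ^ 10 := div_le_div_of_nonneg_right hCC' (pow_nonneg hK 10)
  obtain ⟨tc, htc, hb, ha⟩ := h
  exact ⟨tc, htc.trans h1,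
    fun t ht => ⟨(hb t ht).1.trans h2, fun i hi => ((hb t ht).2 i hi).trans h2⟩,
    fun t ht => ⟨(ha t ht).1.trans h2, fun i hi => ((ha t ht).2 i hi).trans h2⟩⟩

/-- The residual energy of THE trajectory: `a² + b² + c² + d² = 1 - ã²` ((energy-con)).
[cite: Tao2016AveragedNS, §5.5 (energy-con)] -/
theorem delaySolution_residual_eq (K ε t : ℝ) :
    delaySolution K ε t 0 ^ 2 + delaySolution K ε t 1 ^ 2 + delaySolution K ε t 2 ^ 2 +
      delaySolution K ε t 3 ^ 2 = 1 - delaySolution K ε t 4 ^ 2 := by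
  have h := energy_delaySolution K ε t
  simp only [energy, Fin.sum_univ_five] at h
  linarith

/-- Every mode of THE trajectory is bounded by `1` in absolute value. [cite: Tao2016AveragedNS, §5.5 (energy-con)] -/
theorem abs_delaySolution_le_one (K ε t : ℝ) (i : Fin 5) : |delaySolution K ε t i| ≤ 1 := by
  simpa [energy_delaySolution] using abs_apply_le_sqrt_energy (delaySolution K ε t) i

/-- One squared mode is at most the sum of the four non-output squared modes. [folklore] -/
theorem sq_le_residual (Y : Fin 5 → ℝ) {i : Fin 5} (hi : i ≠ 4) :
    Y i ^ 2 ≤ Y 0 ^ 2 + Y 1 ^ 2 + Y 2 ^ 2 + Y 3 ^ 2 := by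
  have h0 := sq_nonneg (Y 0); have h1 := sq_nonneg (Y 1); have h2 := sq_nonneg (Y 2)
  have h3 := sq_nonneg (Y 3)
  fin_cases i
  · show Y 0 ^ 2 ≤ _; linarith
  · show Y 1 ^ 2 ≤ _; linarith
  · show Y 2 ^ 2 ≤ _; linarith
  · show Y 3 ^ 2 ≤ _; linarith
  · exact absurd rfl hi

/-- **The second window of Theorem 5.3 is automatic.** If THE trajectory `delaySolution K ε`
satisfies the conclusion of Theorem 5.3 with the second window collapsed to its first instant
`t₁ = t_c + K^{-1/2}` (constant `C < K¹⁰`, `K ≥ 1`), then it satisfies the printed conclusion for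
all `t ≥ t₁`, with constant `2C + 4C²`: `ã` is non-decreasing and `≤ 1`, so
`a² + b² + c² + d² = 1 - ã² ≤ 1 - ã(t₁)² ≤ 4C²K⁻²⁰` for `t ≥ t₁`.
[cite: Tao2016AveragedNS, Theorem 5.3 (proof, last step)] -/
theorem hasAbruptTransition_of_at {C K ε : ℝ} (hK : 1 ≤ K) (hCK : C < K ^ 10)
    (h : HasAbruptTransitionAt C K (delaySolution K ε)) :
    HasAbruptTransition (2 * C + 4 * C ^ 2) K (delaySolution K ε) := by
  obtain ⟨tc, htc, hbefore, h4, hres⟩ := h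
  have hK0 : 0 < K := by linarith
  have hK10 : 0 < K ^ 10 := pow_pos hK0 10
  have hsqrtK : 0 < Real.sqrt K := Real.sqrt_pos.2 hK0
  -- the implied constant is nonnegative
  have hC : 0 ≤ C := by
    refine le_of_not_gt fun hC' => ?_
    have : C / Real.sqrt K < 0 := div_neg_of_neg_of_pos hC' hsqrtK
    linarith [abs_nonneg (tc - Real.sqrt 2)]
  have hCle : C ≤ 2 * C + 4 * C ^ 2 := by nlinarith
  have hCle' : 4 * C ^ 2 ≤ 2 * C + 4 * C ^ 2 := by linarith
  have hCle'' : 2 * C ≤ 2 * C + 4 * C ^ 2 := by nlinarith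
  have hdiv : C / K ^ 10 ≤ (2 * C + 4 * C ^ 2) / K ^ 10 :=
    div_le_div_of_nonneg_right hCle hK10.le
  -- abbreviations
  set X := delaySolution K ε with hXdef
  set t₁ := tc + 1 / Real.sqrt K with ht₁
  -- `ã(t₁) > 0`
  have hq : C / K ^ 10 < 1 := (div_lt_one hK10).2 hCK
  have ha₁ : 0 < X t₁ 4 := by
    have := (abs_sub_le_iff.1 h4).2
    linarith
  -- residual energy at `t₁`
  have hsq : ∀ i : Fin 5, i ≠ 4 → X t₁ i ^ 2 ≤ (C / K ^ 10) ^ 2 := fun i hi => by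
    have hb := hres i hi
    have h0 : 0 ≤ C / K ^ 10 := div_nonneg hC hK10.le
    rw [← sq_abs]
    exact pow_le_pow_left₀ (abs_nonneg _) hb 2
  have hres₁ : X t₁ 0 ^ 2 + X t₁ 1 ^ 2 + X t₁ 2 ^ 2 + X t₁ 3 ^ 2 ≤ 4 * (C / K ^ 10) ^ 2 := by
    have e0 := hsq 0 (by decide)
    have e1 := hsq 1 (by decide)
    have e2 := hsq 2 (by decide)
    have e3 := hsq 3 (by decide)
    linarith
  have hE₁ := delaySolution_residual_eq K ε t₁
  -- `4 (C/K¹⁰)² ≤ 4C²/K¹⁰`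
  have hCK20 : 4 * (C / K ^ 10) ^ 2 ≤ 4 * C ^ 2 / K ^ 10 := by
    have h1 : 1 ≤ K ^ 10 := one_le_pow₀ hK
    have hinv : (K ^ 10)⁻¹ ≤ 1 := inv_le_one_of_one_le₀ h1
    have hC2 : 0 ≤ 4 * C ^ 2 / K ^ 10 := by positivity
    calc 4 * (C / K ^ 10) ^ 2 = 4 * C ^ 2 / K ^ 10 * (K ^ 10)⁻¹ := by
          field_simp
      _ ≤ 4 * C ^ 2 / K ^ 10 * 1 := mul_le_mul_of_nonneg_left hinv hC2
      _ = 4 * C ^ 2 / K ^ 10 := mul_one _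
  refine ⟨tc, htc.trans (div_le_div_of_nonneg_right hCle hsqrtK.le), fun t ht => ?_, fun t ht => ?_⟩
  · obtain ⟨h0, hi⟩ := hbefore t ht
    exact ⟨h0.trans hdiv, fun i hi' => (hi i hi').trans hdiv⟩
  · -- `t ≥ t₁`: monotone output + energy conservation
    have hmono : X t₁ 4 ≤ X t 4 := delaySolution_output_monotone hK0.le ε ht
    have hle1 : X t 4 ≤ 1 := (le_abs_self _).trans (abs_delaySolution_le_one K ε t 4)
    have hE := delaySolution_residual_eq K ε t
    have hgap : 1 - X t 4 ^ 2 ≤ 4 * (C / K ^ 10) ^ 2 := by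
      have hsq₁ : X t₁ 4 ^ 2 ≤ X t 4 ^ 2 := pow_le_pow_left₀ ha₁.le hmono 2
      linarith
    refine ⟨?_, fun i hi => ?_⟩
    · rw [abs_sub_comm, abs_of_nonneg (by linarith)]
      have : 1 - X t 4 ≤ 1 - X t 4 ^ 2 := by
        have h4nn : 0 ≤ X t 4 := ha₁.le.trans hmono
        nlinarith [mul_nonneg h4nn (sub_nonneg.2 hle1)]
      calc 1 - X t 4 ≤ 4 * (C / K ^ 10) ^ 2 := this.trans hgap
        _ ≤ 4 * C ^ 2 / K ^ 10 := hCK20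
        _ ≤ (2 * C + 4 * C ^ 2) / K ^ 10 := div_le_div_of_nonneg_right hCle' hK10.le
    · have hXi : X t i ^ 2 ≤ (2 * (C / K ^ 10)) ^ 2 := by
        have hsum := sq_le_residual (X t) hi
        linarith
      have h0 : 0 ≤ C / K ^ 10 := div_nonneg hC hK10.le
      have habs : |X t i| ≤ 2 * (C / K ^ 10) := abs_le_of_sq_le_sq hXi (by positivity)
      calc |X t i| ≤ 2 * (C / K ^ 10) := habs
        _ = 2 * C / K ^ 10 := by ring
        _ ≤ (2 * C + 4 * C ^ 2) / K ^ 10 := div_le_div_of_nonneg_right hCle'' hK10.le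

/-- **Theorem 5.3, bounded reading.** The named fact `DelayedAbruptTransition` is equivalent to the
assertion that THE trajectory `delaySolution K ε` satisfies the conclusion of Theorem 5.3 with the
second window collapsed to its first instant `t_c + K^{-1/2}` — i.e. a proof of Theorem 5.3 needs to
control the trajectory on the bounded interval `[0, t_c + K^{-1/2}]` only (as Tao's bootstrap does);
the unbounded window is supplied by `hasAbruptTransition_of_at`.
[cite: Tao2016AveragedNS, Theorem 5.3] -/
theorem delayedAbruptTransition_iff_at :
    DelayedAbruptTransition ↔
      ∃ C : ℝ, 0 < C ∧ ∃ K₀ : ℝ, 0 < K₀ ∧ ∀ K : ℝ, K₀ ≤ K → ∃ ε₁ : ℝ, 0 < ε₁ ∧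
        ∀ ε : ℝ, 0 < ε → ε ≤ ε₁ → HasAbruptTransitionAt C K (delaySolution K ε) := by
  rw [delayedAbruptTransition_iff_delaySolution]
  constructor
  · rintro ⟨C, hC, K₀, hK₀, h⟩
    refine ⟨C, hC, K₀, hK₀, fun K hK => ?_⟩
    obtain ⟨ε₁, hε₁, h'⟩ := h K hK
    exact ⟨ε₁, hε₁, fun ε hε hε' => (h' ε hε hε').hasAbruptTransitionAt⟩
  · rintro ⟨C, hC, K₀, hK₀, h⟩
    refine ⟨2 * C + 4 * C ^ 2, by positivity, max K₀ (C + 1),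
      hK₀.trans_le (le_max_left _ _), fun K hK => ?_⟩
    have hK₀K : K₀ ≤ K := (le_max_left _ _).trans hK
    have hCK : C + 1 ≤ K := (le_max_right _ _).trans hK
    have hK1 : 1 ≤ K := by linarith
    have hC10 : C < K ^ 10 := by
      have : K ≤ K ^ 10 := by
        calc K = K ^ 1 := (pow_one K).symm
          _ ≤ K ^ 10 := pow_le_pow_right₀ hK1 (by norm_num)
      linarith
    obtain ⟨ε₁, hε₁, h'⟩ := h K hK₀K
    exact ⟨ε₁, hε₁, fun ε hε hε' => hasAbruptTransition_of_at hK1 hC10 (h' ε hε hε')⟩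

end Literature.Analysis.FluidPDE.Tao2016AveragedNS

end
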